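import Summits.Ventures.PercRepro2.CaseOneGadgetUWA1OMixA
import Summits.Ventures.PercRepro2.CaseOneGadgetUWA1OMixB
import Summits.Ventures.PercRepro2.CaseOnePendantAnyI

/-!
# The gadget `u ~ {w, a₁, o}`, `w ~ {u, a₂, b}` (uwa1o): the bridge from the forms to the polynomials
(blind cell PercRepro2, p1 g34; generated by mining/p1/g34/uwa1o/gen_polyAO.py)

With `sgAO*_mix` (CaseOneGadgetUWA1OMixA / MixB): **`iiExpr_eq_iiAO5`**, **`iiExprT_eq_iiqAO5`**, **`iExpr_eq_iAO5`**,
**`iExprT_eq_iqAO5`** — the four case-1 forms at `u` are the gadget polynomials at the five edge weights and the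
cell masses of `pin5AO p`. With `iiAO5 ≥ 0` … `iqAO5 ≥ 0` on the cube under `SFacts` (the certificate layer) they give
the four forms at `u` for every finite graph and every weight vector. -/

namespace Summit.Ventures.PercRepro2

namespace CaseOne

section BridgeAO5
variable {V : Type*} {E : Type*} [Fintype E] [DecidableEq E] {R : Type*} [Field R]
variable {ends : E → Sym2 V} {o a₁ a₂ b u w : V} {euw eua1 euo ewa2 ewb : E}

/-- **`iiExpr` at `u` is `iiAO5`** at the five edge weights and the cell masses of the pinned law. -/
theorem iiExpr_eq_iiAO5 (p : E → R) (h : IsGadgetUWA1O ends o a₁ a₂ b u w euw eua1 euo ewa2 ewb) :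
    iiExpr p ends o a₁ a₂ u b = iiAO5 (p euw) (p eua1) (p euo) (p ewa2) (p ewb) (scells (pin5AO p euw eua1 euo ewa2 ewb) ends o a₁ a₂ b) := by
  rw [iiExpr_eq_probs, massgAO_Q p h, massgAO_QB p h, massgAO_QA p h, massgAO_QAO p h, massgAO_QAB p h, massgAO_QABO p h, massgAO_D p h, massgAO_Do p h, ← sgAOQ_mix p euw eua1 euo ewa2 ewb, ← sgAOQB_mix p euw eua1 euo ewa2 ewb, ← sgAOQA_mix p euw eua1 euo ewa2 ewb, ← sgAOQAO_mix p euw eua1 euo ewa2 ewb, ← sgAOQAB_mix p euw eua1 euo ewa2 ewb, ← sgAOQABO_mix p euw eua1 euo ewa2 ewb, ← sgAOD_mix p euw eua1 euo ewa2 ewb, ← sgAODo_mix p euw eua1 euo ewa2 ewb]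
  rfl

/-- **The Q-threshold form at `u` is `iiqAO5`**. -/
theorem iiExprT_eq_iiqAO5 (p : E → R) (h : IsGadgetUWA1O ends o a₁ a₂ b u w euw eua1 euo ewa2 ewb) :
    iiExprT p ends o a₁ a₂ u b (Dqo p ends o a₁ a₂) (prob p (connEvent ends a₁ a₂)ᶜ) =
      iiqAO5 (p euw) (p eua1) (p euo) (p ewa2) (p ewb) (scells (pin5AO p euw eua1 euo ewa2 ewb) ends o a₁ a₂ b) := by
  rw [iiExprT_eq, massgAO_Q p h, massgAO_QB p h, massgAO_QA p h, massgAO_QAO p h, massgAO_QAB p h, massgAO_QABO p h, massgAO_YU p h, ← sgAOQ_mix p euw eua1 euo ewa2 ewb, ← sgAOQB_mix p euw eua1 euo ewa2 ewb, ← sgAOQA_mix p euw eua1 euo ewa2 ewb, ← sgAOQAO_mix p euw eua1 euo ewa2 ewb, ← sgAOQAB_mix p euw eua1 euo ewa2 ewb, ← sgAOQABO_mix p euw eua1 euo ewa2 ewb, ← sgAOYU_mix p euw eua1 euo ewa2 ewb]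
  rfl

/-- **`iExpr` at `u` is `iAO5`**. -/
theorem iExpr_eq_iAO5 (p : E → R) (h : IsGadgetUWA1O ends o a₁ a₂ b u w euw eua1 euo ewa2 ewb) :
    iExpr p ends o a₁ a₂ u b = iAO5 (p euw) (p eua1) (p euo) (p ewa2) (p ewb) (scells (pin5AO p euw eua1 euo ewa2 ewb) ends o a₁ a₂ b) := by
  rw [iExpr_eq_iExprT, iExprT_eq, massgAO_Q p h, massgAO_QA p h, massgAO_QAO p h, massgAO_D p h, massgAO_Do p h, massgAO_QB1 p h, massgAO_QAB1 p h, massgAO_QAB1O p h, ← sgAOQ_mix p euw eua1 euo ewa2 ewb, ← sgAOQA_mix p euw eua1 euo ewa2 ewb, ← sgAOQAO_mix p euw eua1 euo ewa2 ewb, ← sgAOD_mix p euw eua1 euo ewa2 ewb, ← sgAODo_mix p euw eua1 euo ewa2 ewb, ← sgAOQB1_mix p euw eua1 euo ewa2 ewb, ← sgAOQAB1_mix p euw eua1 euo ewa2 ewb, ← sgAOQAB1O_mix p euw eua1 euo ewa2 ewb]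
  rfl

/-- **The `(i)`-side Q-threshold form at `u` is `iqAO5`**. -/
theorem iExprT_eq_iqAO5 (p : E → R) (h : IsGadgetUWA1O ends o a₁ a₂ b u w euw eua1 euo ewa2 ewb) :
    iExprT p ends o a₁ a₂ u b (Dqo p ends o a₁ a₂) (prob p (connEvent ends a₁ a₂)ᶜ) =
      iqAO5 (p euw) (p eua1) (p euo) (p ewa2) (p ewb) (scells (pin5AO p euw eua1 euo ewa2 ewb) ends o a₁ a₂ b) := by
  rw [iExprT_eq, massgAO_Q p h, massgAO_QA p h, massgAO_QAO p h, massgAO_YU p h, massgAO_QB1 p h, massgAO_QAB1 p h, massgAO_QAB1O p h, ← sgAOQ_mix p euw eua1 euo ewa2 ewb, ← sgAOQA_mix p euw eua1 euo ewa2 ewb, ← sgAOQAO_mix p euw eua1 euo ewa2 ewb, ← sgAOYU_mix p euw eua1 euo ewa2 ewb, ← sgAOQB1_mix p euw eua1 euo ewa2 ewb, ← sgAOQAB1_mix p euw eua1 euo ewa2 ewb, ← sgAOQAB1O_mix p euw eua1 euo ewa2 ewb]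
  rfl

end BridgeAO5

end CaseOne

end Summit.Ventures.PercRepro2
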